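import Literature.Probability.Percolation.SlabMSFConnector
import HarnessLib

/-!
# Newman–Tassion–Wu 2017, §4 (proof of Theorem 2.4) — the surgered configuration of the gluing
# lemma for invasion: "`Γ_min(ω′) = Γ_min(ω)`" (no new open circuit) and the closed dual surface
# survives

Topic: `Literature/Probability/Percolation`.  Third file of the port of NTW's Lemma 4.1 (*Critical
percolation and the minimal spanning tree in slabs*, CPAM 70 (2017) = arXiv:1512.09107, §4.1,
pp. 20–21), after `SlabMSFInside.lean` (`R`, `∂R`) and `SlabMSFConnector.lean` (`z′`, `Γ_z`, `Γ_w`,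
`B̄₁^#`).  At the level of CONFIGURATIONS (labels come later): NTW's map `Φ` "open[s] all the edges
in `Γ_z`" (and `Γ_w`) and "close[s] all the edges in `B̄₁^#(z′)` … except for the edges of
`Γ_min(ω) ∪ Γ_z ∪ Γ_w`".  Here, for a vertex list `Γ` (the minimal circuit), a landing vertex `z` and
a second vertex `w`:

* `NTW17.surgS k Γ y` — the set `S` of modified pairs: the slab edges inside `B̄₁^#(y)` with an
  endpoint off `Γ` (we keep every pair joining two vertices of `Γ`, not only the circuit's edges —
  harmless and simpler);
* `NTW17.cfgZ k ω Γ z = (ω ∖ S) ∪ E(Γ_z)` — the configuration after Steps 1 and 3 (NTW's `η₃⁻` in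
  the lane's reading (R2′) of Step 2, see below); `NTW17.cfgZW k ω Γ z w = cfgZ ∪ E(Γ_w)` — after
  Step 2 as well.

PROVED:
* `IsOpenCircuit.of_needle` — the abstract form of NTW's "the construction will not create any new
  `p_c`-open circuits": for a needle (a list without duplicates whose inner vertices carry only
  needle pairs in `ω'`, every other `ω'`-open pair being `ω`-open) whose two ends are NOT joined by
  an `ω`-open path inside `A`, every `ω'`-open circuit inside `A` with at least three vertices is
  `ω`-open — packaged from the circuit-gluing layer's `needle_circuit` (`SlabCircuitNeedle.lean`).
* `isOpenCircuit_of_cfgZ` — under (f1) "`z ∉ C_{p_c}(Γ_min(ω))`", every `cfgZ`-open circuit (`≥ 3`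
  vertices) is `ω`-open (the one-needle lemma applied to `Γ_z`); `minCircuit_cfgZ` — **(f2)
  `Γ_min` is unchanged by Steps 1 and 3** for `Γ = minCircuit`; `cfgZ_mem_circuitAround`.
* bookkeeping: `cfgZ`/`cfgZW` are lattice configurations, agree with `ω` off `plusEdges`, keep `Γ`
  open; inner vertices of the connectors (`inner_connector`).
The Step-2 half (`isOpenCircuit_of_cfgZW`, `minCircuit_cfgZW`: the needle `Γ_w` ends on `Γ_z ∪ Γ`,
and the end of a needle is unconstrained, so the junction of `Γ_w` with `Γ_z` costs nothing) and the
survival of the closed dual surface (repair (R1)) are in `SlabMSFNoNewCircuitW.lean`.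

Reading (R2′) of Step 2 (lane scoping memo `SEQUEL-MSF.md` §3): NTW's test "if `w ∈ C_{p_c}(z)`, go
to Step 3" is applied in `cfgZ` (after Steps 1 and 3) and as "`w` joined to `Γ_min`"; read in `ω` as
printed, the three-case contradiction of p. 21 does not go through.  The theorem is unchanged.

## Sources

* C. M. Newman, V. Tassion, W. Wu, *Critical percolation and the minimal spanning tree in slabs*,
  Comm. Pure Appl. Math. 70 (2017) 2084–2120 = arXiv:1512.09107: §4.1, proof of Lemma 4.1, Steps
  1–3, (f1), (f2) ("the construction will not create any new p_c-open circuits"), p. 21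
  [NewmanTassionWu2017].
-/

noncomputable section

namespace Literature.Probability.Percolation

open MeasureTheory LatticeModels SimpleGraph

namespace NTW17

variable {k : ℕ}

/-! ## No new circuit through a needle (abstract form) -/

/-- An open path inside `A` gives reachability in the open graph. [folklore] -/
private theorem reachable_of_openConnIn' {ω : BondConfig (slab 3 k)} {A : Set (slab 3 k)} {a b : slab 3 k}
    (h : ω ∈ openConnIn A a b) : (openGraph ω).Reachable a b := by
  obtain ⟨_, _, hr⟩ := h
  exact hr.map (SimpleGraph.Embedding.induce A).toHom

/-- Planar-adjacent points are distinct. [folklore] -/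
private theorem ne_of_planarAdj' {z w : ℤ × ℤ} (h : planarAdj z w) : z ≠ w := by
  rintro rfl
  obtain ⟨a, b⟩ := z
  simp only [planarAdj, Prod.mk_add_mk, Prod.mk.injEq] at h
  omega

/-- **No new circuit through a needle.**  Let `Ndl` be a list without duplicates such that every
`ω'`-open pair at an inner vertex of `Ndl` is a pair of consecutive vertices of `Ndl`, every
`ω'`-open pair which is not such a pair is `ω`-open, and the last vertex of `Ndl` is NOT joined to
its first vertex by an `ω`-open path inside `A`.  Then every `ω'`-open circuit inside `A` with at least
three vertices is `ω`-open.  (NTW: "any new `p_c`-open circuit would contain a subset of `Γ_z`, and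
then it would contain all of `Γ_z` … Therefore … we would have `z(ω) ∈ C_{p_c}(Γ_min(ω))`".)
[cite: NewmanTassionWu2017, §4.1 (proof of Lemma 4.1, (f2): "the construction will not create any new p_c-open circuits")] -/
theorem IsOpenCircuit.of_needle {ω ω' : BondConfig (slab 3 k)} {A : Set (slab 3 k)}
    {Ndl : List (slab 3 k)} (hnd : Ndl.Nodup) (hne : Ndl ≠ []) {a b : slab 3 k}
    (ha : Ndl.head hne = a) (hb : Ndl.getLast hne = b)
    (H : ∀ (x z : slab 3 k) (m₁ m₂ : List (slab 3 k)), Ndl = m₁ ++ x :: m₂ → m₁ ≠ [] → m₂ ≠ [] →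
      s(x, z) ∈ ω' → (∃ l₁ l₂, Ndl = l₁ ++ x :: z :: l₂) ∨ (∃ l₁ l₂, Ndl = l₁ ++ z :: x :: l₂))
    (Hω : ∀ e ∈ ω', e ∉ edgesOf Ndl → e ∈ ω) (hends : ω ∉ openConnIn A b a)
    {l : List (slab 3 k)} (hl : IsOpenCircuit k ω' A l) (h3 : 3 ≤ l.length) :
    IsOpenCircuit k ω A l := by
  by_cases hall : (∀ (a b : slab 3 k) (l₁ l₂ : List (slab 3 k)), l = l₁ ++ a :: b :: l₂ → s(a, b) ∈ ω) ∧
      (∀ hne : l ≠ [], s(l.getLast hne, l.head hne) ∈ ω)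
  · exact hl.of_consecutive hall.1 hall.2
  exfalso
  -- a pair of the circuit which is new: a needle pair, cyclically consecutive on `l`
  have hbad : ∃ x z, s(x, z) ∈ edgesOf Ndl ∧
      ((∃ l₁ l₂, l = l₁ ++ x :: z :: l₂) ∨ (∃ hne : l ≠ [], l.getLast hne = x ∧ l.head hne = z)) := by
    rw [not_and_or] at hall
    rcases hall with hall | hall
    · push Not at hall
      obtain ⟨a, b, l₁, l₂, heq, hab⟩ := hall
      have hab' : s(a, b) ∈ ω' := ((List.isChain_iff_forall_rel_of_append_cons_cons.1 hl.chain) heq).1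
      refine ⟨a, b, ?_, Or.inl ⟨l₁, l₂, heq⟩⟩
      by_contra hE; exact hab (Hω _ hab' hE)
    · push Not at hall
      obtain ⟨hne', hab⟩ := hall
      refine ⟨l.getLast hne', l.head hne', ?_, Or.inr ⟨hne', rfl, rfl⟩⟩
      by_contra hE; exact hab (Hω _ (hl.closing hne').1 hE)
  obtain ⟨x, z, hE, hcyc⟩ := hbad
  obtain ⟨p, q, n₁, n₂, hN, hpq⟩ := hE
  -- a rotation (possibly of the reversed circuit) starting with the needle pair in needle order
  have hrot : ∃ T, IsOpenCircuit k ω' A (p :: q :: T) ∧ 3 ≤ (p :: q :: T).length := by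
    rcases Sym2.eq_iff.1 hpq with ⟨hxp, hzq⟩ | ⟨hxq, hzp⟩
    · subst hxp hzq
      obtain ⟨T, hT, hlen⟩ := hl.exists_rotate_pair hcyc
      exact ⟨T, hT, by omega⟩
    · subst hxq hzp
      have hcyc' : (∃ l₁ l₂, l.reverse = l₁ ++ z :: x :: l₂) ∨
          (∃ hne : l.reverse ≠ [], l.reverse.getLast hne = z ∧ l.reverse.head hne = x) := by
        rcases hcyc with ⟨l₁, l₂, heq⟩ | ⟨hne', h1, h2⟩
        · exact Or.inl ⟨l₂.reverse, l₁.reverse, by rw [heq]; simp⟩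
        · refine Or.inr ⟨by simpa using hne', ?_, ?_⟩
          · rw [List.getLast_reverse]; exact h2
          · rw [List.head_reverse]; exact h1
      obtain ⟨T, hT, hlen⟩ := hl.reverse.exists_rotate_pair hcyc'
      exact ⟨T, hT, by rw [List.length_reverse] at hlen; omega⟩
  obtain ⟨T, hT, hT3⟩ := hrot
  have hconn := needle_circuit (A := A) hnd hne H Hω n₁.length n₁ le_rfl p q n₂ T hN hT hT3
  rw [ha, hb] at hconn
  exact hends hconn

/-! ## The surgered configurations -/

variable (k)

/-- **The modified pair set `S`**: the slab edges inside `B̄₁^#(y)` with an endpoint off `Γ`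
("`S(ω′) = B̄₁^#(z′) ∖ Γ_min(ω′)`"; pairs joining two vertices of `Γ` are kept).
[cite: NewmanTassionWu2017, §4.1 (proof of Lemma 4.1: "Taking S(ω′) = B̄₁^#(z′) ∖ Γ_min(ω′)")] -/
def surgS (Γ : List (slab 3 k)) (y : ℤ × ℤ) : Set (Sym2 (slab 3 k)) :=
  {e | e ∈ plusEdges k y ∧ ∃ v ∈ e, v ∉ Γ}

/-- **The configuration after Steps 1 and 3** (`Γ_z` opened, every other modifiable pair of the plus
cylinder closed): `(ω ∖ S) ∪ E(Γ_z)`.  In the lane's reading (R2′) this is also the configuration in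
which Step 2's test is performed. [cite: NewmanTassionWu2017, §4.1 (proof of Lemma 4.1, Steps 1 and 3)] -/
def cfgZ (ω : BondConfig (slab 3 k)) (Γ : List (slab 3 k)) (z : slab 3 k) : BondConfig (slab 3 k) :=
  (ω \ surgS k Γ (landCol k Γ z)) ∪ edgesOf (gammaZ k Γ z)

/-- **The configuration after Steps 1, 2 and 3** (`Γ_z` and `Γ_w` opened, every other modifiable
pair of the plus cylinder closed): `cfgZ ∪ E(Γ_w)`. [cite: NewmanTassionWu2017, §4.1 (proof of Lemma 4.1, Steps 1–3)] -/
def cfgZW (ω : BondConfig (slab 3 k)) (Γ : List (slab 3 k)) (z w : slab 3 k) : BondConfig (slab 3 k) :=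
  cfgZ k ω Γ z ∪ edgesOf (gammaW k Γ z w)

variable {k}

section Basic

variable {ω : BondConfig (slab 3 k)} {Γ : List (slab 3 k)} {z w : slab 3 k}

/-- `S ⊆` the edges inside the plus cylinder. [cite: NewmanTassionWu2017, §4.1 (S(ω′) ⊆ B̄₁^#(z′))] -/
theorem surgS_subset_plusEdges (Γ : List (slab 3 k)) (y : ℤ × ℤ) : surgS k Γ y ⊆ plusEdges k y :=
  fun _ h => h.1

/-- A pair joining two vertices of `Γ` is not modified. [cite: NewmanTassionWu2017, §4.1 ("except for the edges of Γ_min(ω)")] -/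
theorem not_mem_surgS_of_mem {y : ℤ × ℤ} {a b : slab 3 k} (ha : a ∈ Γ) (hb : b ∈ Γ) :
    s(a, b) ∉ surgS k Γ y := by
  rintro ⟨-, v, hv, hvΓ⟩
  rcases Sym2.mem_iff.1 hv with rfl | rfl
  · exact hvΓ ha
  · exact hvΓ hb

/-- A slab edge at a vertex over `y` which is off `Γ` is modified. [cite: NewmanTassionWu2017, §4.1 (S(ω′) = B̄₁^#(z′) ∖ Γ_min)] -/
theorem mem_surgS_of_adj {y : ℤ × ℤ} {x q : slab 3 k} (hxy : planar k x = y) (hxΓ : x ∉ Γ)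
    (hadj : (slabGraph 3 k).Adj x q) : s(x, q) ∈ surgS k Γ y :=
  ⟨mem_plusEdges_of_adj hxy hadj, x, Sym2.mem_mk_left _ _, hxΓ⟩

/-- `cfgZ ⊆ cfgZW`. [cite: NewmanTassionWu2017, §4.1 (Steps 1–3)] -/
theorem cfgZ_subset_cfgZW : cfgZ k ω Γ z ⊆ cfgZW k ω Γ z w := Set.subset_union_left

/-- The unmodified part of `ω` lies in `cfgZ`. [cite: NewmanTassionWu2017, §4.1 (ω|_{S^c} = ω′|_{S^c})] -/
theorem diff_subset_cfgZ : ω \ surgS k Γ (landCol k Γ z) ⊆ cfgZ k ω Γ z := Set.subset_union_left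

/-- Off the plus cylinder, `cfgZ` agrees with `ω`. [cite: NewmanTassionWu2017, §4.1 (ω|_{S^c} = ω′|_{S^c})] -/
theorem mem_cfgZ_iff_of_not_mem_plusEdges (hz : ∃ g ∈ Γ, planarAdj (planar k z) (planar k g))
    {e : Sym2 (slab 3 k)} (he : e ∉ plusEdges k (landCol k Γ z)) : e ∈ cfgZ k ω Γ z ↔ e ∈ ω := by
  obtain ⟨g, hg⟩ := exists_nearestOver_gammaZ hz
  constructor
  · rintro (⟨h, -⟩ | h)
    · exact h
    · exact absurd (edgesOf_connector_subset hg (landCol_spec hz).2 h) he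
  · exact fun h => Or.inl ⟨h, fun hS => he hS.1⟩

/-- Off the plus cylinder, `cfgZW` agrees with `ω`. [cite: NewmanTassionWu2017, §4.1 (ω|_{S^c} = ω′|_{S^c})] -/
theorem mem_cfgZW_iff_of_not_mem_plusEdges (hz : ∃ g ∈ Γ, planarAdj (planar k z) (planar k g))
    (hw : planarAdj (planar k w) (landCol k Γ z)) {e : Sym2 (slab 3 k)}
    (he : e ∉ plusEdges k (landCol k Γ z)) : e ∈ cfgZW k ω Γ z w ↔ e ∈ ω := by
  obtain ⟨g, hg⟩ := exists_nearestOver_gammaW (w := w) hz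
  rw [cfgZW, Set.mem_union, mem_cfgZ_iff_of_not_mem_plusEdges hz he]
  constructor
  · rintro (h | h)
    · exact h
    · exact absurd (edgesOf_connector_subset hg hw h) he
  · exact fun h => Or.inl h

/-- `cfgZ` is a lattice configuration. [cite: NewmanTassionWu2017, §4.1 (ω′ ∈ Ω)] -/
theorem cfgZ_subset_edgeSet (hω : ω ⊆ (slabGraph 3 k).edgeSet)
    (hz : ∃ g ∈ Γ, planarAdj (planar k z) (planar k g)) : cfgZ k ω Γ z ⊆ (slabGraph 3 k).edgeSet := by
  obtain ⟨g, hg⟩ := exists_nearestOver_gammaZ hz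
  rintro e (⟨h, -⟩ | h)
  · exact hω h
  · exact edgesOf_subset_edgeSet (connector_chain hg (landCol_spec hz).2) h

/-- `cfgZW` is a lattice configuration. [cite: NewmanTassionWu2017, §4.1 (ω′ ∈ Ω)] -/
theorem cfgZW_subset_edgeSet (hω : ω ⊆ (slabGraph 3 k).edgeSet)
    (hz : ∃ g ∈ Γ, planarAdj (planar k z) (planar k g)) (hw : planarAdj (planar k w) (landCol k Γ z)) :
    cfgZW k ω Γ z w ⊆ (slabGraph 3 k).edgeSet := by
  obtain ⟨g, hg⟩ := exists_nearestOver_gammaW (w := w) hz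
  rintro e (h | h)
  · exact cfgZ_subset_edgeSet hω hz h
  · exact edgesOf_subset_edgeSet (connector_chain hg hw) h

/-- **`Γ` stays an open circuit** after Steps 1 and 3 (its pairs are not modified).
[cite: NewmanTassionWu2017, §4.1 ("except for the edges of Γ_min(ω)")] -/
theorem isOpenCircuit_cfgZ {A : Set (slab 3 k)} (hΓ : IsOpenCircuit k ω A Γ) :
    IsOpenCircuit k (cfgZ k ω Γ z) A Γ :=
  hΓ.of_edges fun _ ha _ hb hab => Or.inl ⟨hab, not_mem_surgS_of_mem ha hb⟩

/-- `Γ` stays an open circuit after Steps 1–3. [cite: NewmanTassionWu2017, §4.1 ("except for the edges of Γ_min(ω)")] -/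
theorem isOpenCircuit_cfgZW {A : Set (slab 3 k)} (hΓ : IsOpenCircuit k ω A Γ) :
    IsOpenCircuit k (cfgZW k ω Γ z w) A Γ :=
  (isOpenCircuit_cfgZ hΓ).mono cfgZ_subset_cfgZW

end Basic

/-! ## Inner vertices of the connectors -/

section Inner

variable {L : List (slab 3 k)} {y : ℤ × ℤ} {u g : slab 3 k}

/-- An inner vertex of a connector (neither its head nor its last vertex) lies over `y` and is not in
the target list. [cite: NewmanTassionWu2017, §4.1 (Γ_z "without touching any other vertices in Γ_min")] -/
theorem inner_connector (hg : nearestOver k L y (ht u) = some g) (huy : planar k u ≠ y)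
    {x : slab 3 k} {m₁ m₂ : List (slab 3 k)} (hl : connector k L y u = m₁ ++ x :: m₂) (hm₁ : m₁ ≠ [])
    (hm₂ : m₂ ≠ []) : planar k x = y ∧ x ∉ L ∧ x ∈ connector k L y u := by
  have hnd := connector_nodup hg huy
  have hx : x ∈ connector k L y u := by rw [hl]; simp
  have hxu : x ≠ u := by
    rintro rfl
    obtain ⟨c, m₁', rfl⟩ := List.exists_cons_of_ne_nil hm₁
    have hc : (connector k L y x).head (connector_ne_nil L y x) = c := by
      simp only [hl, List.cons_append, List.head_cons]
    rw [connector_head] at hc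
    subst hc
    rw [hl, List.cons_append, List.nodup_cons] at hnd
    exact hnd.1 (by simp)
  have hxg : x ≠ g := by
    intro hxg
    have hlast := connector_getLast (L := L) hg
    rw [List.getLast_congr _ (by rw [← hl]; exact connector_ne_nil L y u) hl,
      List.getLast_append_of_ne_nil _ (List.cons_ne_nil _ _), List.getLast_cons hm₂] at hlast
    rw [hl, List.nodup_append] at hnd
    exact (List.nodup_cons.1 hnd.2.1).1 (hxg ▸ hlast ▸ List.getLast_mem hm₂)
  exact ⟨planar_eq_of_mem_connector hg hx hxu, fun hxL => hxg (eq_last_of_mem_connector_of_mem hg hx hxu hxL), hx⟩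

end Inner

/-! ## No new circuit: Step 1 + Step 3 -/

section StepZ

variable {ω : BondConfig (slab 3 k)} {Γ : List (slab 3 k)} {z : slab 3 k}

/-- **The needle property of `cfgZ` along `Γ_z`**: an open pair at an inner vertex of `Γ_z` is a pair
of consecutive vertices of `Γ_z` (every other slab edge there is a modified, hence closed, pair).
[cite: NewmanTassionWu2017, §4.1 (proof of Lemma 4.1, Step 3)] -/
theorem cfgZ_needle (hω : ω ⊆ (slabGraph 3 k).edgeSet) (hz : ∃ g ∈ Γ, planarAdj (planar k z) (planar k g)) :
    ∀ (x q : slab 3 k) (m₁ m₂ : List (slab 3 k)), gammaZ k Γ z = m₁ ++ x :: m₂ → m₁ ≠ [] → m₂ ≠ [] →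
      s(x, q) ∈ cfgZ k ω Γ z →
      (∃ l₁ l₂, gammaZ k Γ z = l₁ ++ x :: q :: l₂) ∨ (∃ l₁ l₂, gammaZ k Γ z = l₁ ++ q :: x :: l₂) := by
  intro x q m₁ m₂ hl hm₁ hm₂ hxq
  obtain ⟨g, hg⟩ := exists_nearestOver_gammaZ hz
  have hzy := planar_ne_landCol hz
  obtain ⟨hxy, hxΓ, -⟩ := inner_connector hg hzy hl hm₁ hm₂
  have hE : s(x, q) ∈ edgesOf (gammaZ k Γ z) := by
    rcases hxq with ⟨hxqω, hxqS⟩ | h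
    · exact absurd (mem_surgS_of_adj hxy hxΓ ((SimpleGraph.mem_edgeSet _).1 (hω hxqω))) hxqS
    · exact h
  rcases next_of_mem_edgesOf (connector_nodup hg hzy) hl hE with ⟨r', hr'⟩ | ⟨l₁', hl₁'⟩
  · exact Or.inl ⟨m₁, r', by rw [hl, hr']⟩
  · exact Or.inr ⟨l₁', m₂, by rw [hl, hl₁']; simp⟩

/-- **No new circuit after Steps 1 and 3.**  If `z` is not joined to any vertex of `Γ` by an
`ω`-open path ((f1): "`z(ω) ∉ C_{p_c}(Γ_min(ω))`"), every `cfgZ`-open circuit with at least three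
vertices is `ω`-open. [cite: NewmanTassionWu2017, §4.1 (proof of Lemma 4.1: "If the construction skips Step 2, then any new p_c-open circuit would contain … all of Γ_z … which would contradict (f1)")] -/
theorem isOpenCircuit_of_cfgZ (hω : ω ⊆ (slabGraph 3 k).edgeSet)
    (hz : ∃ g ∈ Γ, planarAdj (planar k z) (planar k g))
    (hf1 : ∀ g ∈ Γ, ¬ (openGraph ω).Reachable z g) {A : Set (slab 3 k)} {l : List (slab 3 k)}
    (hl : IsOpenCircuit k (cfgZ k ω Γ z) A l) (h3 : 3 ≤ l.length) : IsOpenCircuit k ω A l := by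
  obtain ⟨g, hg⟩ := exists_nearestOver_gammaZ hz
  have hzy := planar_ne_landCol hz
  refine IsOpenCircuit.of_needle (connector_nodup hg hzy) (connector_ne_nil _ _ _)
    (connector_head _ _ _) (connector_getLast hg) (cfgZ_needle hω hz)
    (fun e he hne => ?_) (fun hconn => ?_) hl h3
  · rcases he with ⟨h, -⟩ | h
    · exact h
    · exact absurd h hne
  · exact hf1 g (nearestOver_spec hg).1 (reachable_of_openConnIn' hconn).symm

/-- **`Γ_min` is unchanged by Steps 1 and 3** (`Γ = minCircuit`): `Γ` stays open, and a surrounding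
open circuit of the new configuration is an old one. [cite: NewmanTassionWu2017, §4.1 (proof of Lemma 4.1, (f2): Γ_min(ω′) = Γ_min(ω))] -/
theorem minCircuit_cfgZ (hω : ω ⊆ (slabGraph 3 k).edgeSet) {c : ℤ × ℤ} {m n : ℕ}
    (hC : ω ∈ circuitAround k c m n) (hΓ : Γ = minCircuit k ω c m n)
    (hz : ∃ g ∈ Γ, planarAdj (planar k z) (planar k g))
    (hf1 : ∀ g ∈ Γ, ¬ (openGraph ω).Reachable z g) :
    minCircuit k (cfgZ k ω Γ z) c m n = Γ := by
  obtain ⟨⟨hΓc, hΓs⟩, hΓmin⟩ := minCircuit_spec hC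
  rw [← hΓ] at hΓc hΓs hΓmin
  exact minCircuit_eq_of_min (isOpenCircuit_cfgZ hΓc) hΓs fun l hl hs =>
    hΓmin l (isOpenCircuit_of_cfgZ hω hz hf1 hl (IsOpenCircuit.three_le_length_of_surrounds hs)) hs

/-- After Steps 1 and 3 the surrounding-circuit event still holds. [cite: NewmanTassionWu2017, §4.1 (ω′ ∈ C_{n_i,2n_i})] -/
theorem cfgZ_mem_circuitAround {c : ℤ × ℤ} {m n : ℕ} (hC : ω ∈ circuitAround k c m n)
    (hΓ : Γ = minCircuit k ω c m n) : cfgZ k ω Γ z ∈ circuitAround k c m n := by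
  obtain ⟨⟨hΓc, hΓs⟩, -⟩ := minCircuit_spec hC
  rw [← hΓ] at hΓc hΓs
  exact ⟨Γ, isOpenCircuit_cfgZ hΓc, hΓs⟩

end StepZ

end NTW17

end Literature.Probability.Percolation
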